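import Literature.NumberTheory.EllipticCurves.TowerTorsionCutProofs
import Literature.NumberTheory.EllipticCurves.TowerPresentedSubquotientCohomologyProofs
import Literature.NumberTheory.GaloisRepresentations.GaloisCohomologyScalarAction
import HarnessLib

/-!
# The torsion cut on a PRESENTED tower of discrete Galois modules with scalars: the structural hypotheses of
# `Tower.map_levelCondition_eq_map_torsionCut` from the presentation (theorems only; no definition, no named fact,
# no instance, no `sorry`)

`Proofs` file, companion of `TowerTorsionCutProofs` (pure tower algebra: the residual image of a saturated level condition
is the residual image of the torsion cut `{π^r · pr y = 0}`) and of x10b-p1-w6's `TowerPresentedSubquotient[Cohomology]Proofs`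
(the induced two-index family `q a b` on the quotient tower `W_j ⧸ Fil_j`, naturality of `H¹(mkQ)`).  Cell `pub/bsd-print-x9`,
brick (H5B-P-ANOM) of `Stmt.h5bAtS` (Howard's H.5(b) at `v ∣ p`), road «uniform involution», file F2 of the design
(seat `bsd-line-x9-p1-w3` g6).

SETTING.  A tower `W : ℕ → Type` of discrete `Γ_F`-modules that are `R`-modules with `R`-linear actions (`hlin`), presented
(Howard Def. 1.1.3, arXiv:1202.6340 p. 5 L93–99) by ONE two-index family of continuous equivariant `R`-linear maps `f a b`
(identities `hid / hcomp / hsq / hsurj / hex`, `hpow : f ℓ (ℓ+n) ∘ f (ℓ+n) ℓ = π^n •` for a scalar `π ∈ R`), with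
`Γ_F`-stable, `R`-stable plus parts `Fil_j ≤ W_j` satisfying (map) / (ONTO) / (SAT) along `f`, an induced quotient family `q a b`
(`q a b [x] = [f a b x]`, `Tower.exists_quotFamily_apply_mk`) and quotient endomorphisms `πq j n [x] = [π^n x]`
(`Tower.exists_quotPowFamily_apply_mk` below).  THE TOWERS of `TowerTorsionCutProofs` are then `H_j = H¹(F, W_j)`,
`G_j = H¹(F, W_j ⧸ Fil_j)`, `fH a b = H¹(f a b)`, `fG a b = H¹(q a b)`, `pr_j = H¹(W_j ↠ W_j ⧸ Fil_j)` (`DiscreteGaloisModule.quotientMap`,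
kernel = the STRICT condition `strictSubgroup`), `πH_j = H¹(π •)` (`scalarMapH1`), `πG_j = H¹(πq j 1)`.  THIS FILE derives the
structural hypotheses `hidH / hcompH / hpr / hπH / hπG / hprπ` (functoriality on cocycles), `hπ1` (from `π · W_1 = 0`), `hSat`
(from `(π^m + p) · W_j = 0`, `r ≤ m`), `hE` (x10b-p1-w7's (E) `exists_forall_map_eq_of_apply_eq_zero` on the quotient tower),
identifies the torsion cut `{y | π^r (pr y) = 0}` with `(strictSubgroup).comap H¹(π^r •)`, and concludes

  **`Tower.map_levelCondition_eq_map_comap_strict`**: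
  `(levelCondition (H¹(f (j+1) j)) p (strictSubgroup (ρ j) (Fil j)) N).map H¹(f N 1)
     = ((strictSubgroup (ρ N) (Fil N)).comap H¹(π^r •)).map H¹(f N 1)`

from the three genuinely COHOMOLOGICAL inputs left as hypotheses: (hTor) the torsion compatible families of the quotient tower are
killed by `H¹(πq j r)` (no invariants of `W_d ⧸ Fil_d` survive `π^r`; Howard's control index, Lemma 3.2.7), (hF2)
`H¹(πq j c) H¹(F, W_j ⧸ Fil_j)` lifts to `H¹(F, W_j)` (`π^c` kills `H²(F, Fil_j)`), (hLift) every class of `H¹(F, W_N)` agrees below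
`N - c'` with a compatible family (`π^{c'}` kills `H²(F, W_i)`).  For `W_j = T_𝔮/π^j` at `v ∣ p` this is Howard's «`F_𝔮` propagated
to `T̄`» read inside `T_𝔮/π^N` (Def. 3.1.2, §3.1, p. 15 L99–108).  No summit statement is proved; BSD is not proved by any of this.

References: [Howard2004HeegnerKolyvagin] Def. 1.1.1, Def. 1.1.3, §1.3 H.5(b), §1.6, Def. 3.1.2, §3.1, Def. 3.2.5–3.2.6, Lemma 3.2.7
(arXiv:1202.6340 p. 5, p. 7 L96–97, p. 12, p. 15–16); [MazurRubinMemoirs2004] Def. 1.1.1, Example 1.1.2; [SerreGaloisCohomology1997]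
I §2.2, §2.4, §5.1; [GreenbergLNM1716] §2; [WashingtonCSS1997] §7.
-/

set_option autoImplicit false

noncomputable section

open CategoryTheory
open scoped ContRepresentation

namespace Literature.NumberTheory.EllipticCurves

namespace Tower

open Literature.NumberTheory.GaloisRepresentations
open Literature.NumberTheory.GaloisRepresentations.DiscreteGaloisModule

variable {F : Type} [Field F] {R : Type} [CommRing R]
variable {W : ℕ → Type} [∀ j, AddCommGroup (W j)] [∀ j, Module R (W j)] [∀ j, TopologicalSpace (W j)]
  [∀ j, DiscreteTopology (W j)]
variable (ρ : ∀ j, DiscreteGaloisModule F (W j)) (hlin : ∀ j, (ρ j).IsScalarLinear R)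
variable (f : ∀ a b, (ρ a).toContRepresentation →ⁱL (ρ b).toContRepresentation)
variable (π : R) (Fil : ∀ j, Submodule ℤ (W j))
variable (hΓ : ∀ j (σ : Field.absoluteGaloisGroup F), Fil j ≤ (Fil j).comap (ρ j σ))

/-! ## §1 `H¹` of an endomorphism acting as an integer; powers of scalars on `H¹` -/

/-- If a continuous equivariant endomorphism acts as the integer `n` on the module, it acts as `n` on `H¹`.
[cite: SerreGaloisCohomology1997, Ch. I §2.2 (functoriality of Hⁿ(G, A) in A) and §5.1 (H¹ via cocycles)] -/
theorem map_eq_zsmul_of_forall_apply_eq {M : Type} [AddCommGroup M] [TopologicalSpace M] [DiscreteTopology M]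
    {τ : DiscreteGaloisModule F M} (g : τ.toContRepresentation →ⁱL τ.toContRepresentation) (n : ℤ)
    (hg : ∀ x, g x = n • x) (c : galoisCohomology τ 1) : galoisCohomology.map g 1 c = n • c := by
  obtain ⟨φ, rfl⟩ := oneCocycleClass_surjective _ c
  rw [galoisCohomology.map_oneCocycleClass_ofHom]
  have hφ : contOneCocycles.pullback (ContinuousMonoidHom.id (Field.absoluteGaloisGroup F))
      (X := τ.toTopRep) (Y := τ.toTopRep) (TopRep.ofHom ⟨g.toContinuousLinearMap, g.isIntertwining'⟩) φ = n • φ :=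
    Subtype.ext (ContinuousMap.ext fun σ ↦ by rw [contOneCocycles.pullback_apply]; exact hg _)
  rw [hφ]
  exact map_zsmul (oneCocycleClassₗ τ.toTopRep) n φ

/-- **Powers of a scalar on `H¹`**: `H¹(π •)^n = H¹(π^n •)` in the endomorphism monoid of `H¹(F, M)`.
[cite: SerreGaloisCohomology1997, Ch. I §2.2 (functoriality of Hⁿ(G, A) in A)] -/
theorem scalarMapH1_pow {M : Type} [AddCommGroup M] [Module R M] [TopologicalSpace M] [DiscreteTopology M]
    (τ : DiscreteGaloisModule F M) (hτ : τ.IsScalarLinear R) (r : R) (n : ℕ) (c : galoisCohomology τ 1) :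
    ((@id (AddMonoid.End (galoisCohomology τ 1)) (galoisCohomology.scalarMapH1 τ hτ r)) ^ n) c =
      galoisCohomology.scalarMapH1 τ hτ (r ^ n) c := by
  induction n generalizing c with
  | zero =>
    rw [pow_zero, pow_zero, AddMonoid.End.one_apply, galoisCohomology.scalarMapH1_one]
    rfl
  | succ n ih =>
    rw [endPow_succ_apply', ih, pow_succ', galoisCohomology.scalarMapH1_mul]
    rfl

/-! ## §2 The quotient endomorphisms `[x] ↦ [π^n x]` and the module identities of the induced maps -/

include hlin in
/-- **Existence of the quotient endomorphisms**: for `R`-stable `Γ_F`-stable `Fil_j ≤ W_j` there are continuous equivariant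
endomorphisms `πq j n` of `W_j ⧸ Fil_j` with `πq j n [x] = [π^n • x]` (`Submodule.mapQ` of the scalar `π^n`).
[cite: Howard2004HeegnerKolyvagin, Def. 1.1.1 and §3.1 (arXiv p. 5 L20–21: local conditions are R-submodules; p. 15: Fil_v T_𝔮 an S_𝔮-submodule)] -/
theorem exists_quotPowFamily_apply_mk (hFilR : ∀ j (r : R) (x : W j), x ∈ Fil j → r • x ∈ Fil j) :
    ∃ πq : ∀ j (n : ℕ), ((ρ j).quotient (Fil j) (hΓ j)).toContRepresentation →ⁱL
        ((ρ j).quotient (Fil j) (hΓ j)).toContRepresentation,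
      ∀ j n (x : W j), πq j n (Submodule.Quotient.mk x) = Submodule.Quotient.mk (π ^ n • x) := by
  have hle : ∀ j (n : ℕ), Fil j ≤ (Fil j).comap
      (scalarIntertwining (ρ j) (hlin j) (π ^ n)).toContinuousLinearMap.toLinearMap :=
    fun j n w hw ↦ hFilR j (π ^ n) w hw
  refine ⟨fun j n ↦
    { toContinuousLinearMap :=
        ⟨(Fil j).mapQ (Fil j) (scalarIntertwining (ρ j) (hlin j) (π ^ n)).toContinuousLinearMap.toLinearMap (hle j n),
          continuous_of_discreteTopology⟩
      isIntertwining' := fun σ ↦ by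
        refine ContinuousLinearMap.ext fun x ↦ ?_
        induction x using Submodule.Quotient.induction_on with
        | _ w =>
          change (Fil j).mapQ (Fil j) _ (hle j n) (((ρ j).quotient (Fil j) (hΓ j)) σ (Submodule.Quotient.mk w)) =
            ((ρ j).quotient (Fil j) (hΓ j)) σ ((Fil j).mapQ (Fil j) _ (hle j n) (Submodule.Quotient.mk w))
          rw [ContinuousRep.quotient_apply_mk, Submodule.mapQ_apply, Submodule.mapQ_apply,
            ContinuousRep.quotient_apply_mk]
          exact congrArg _ ((scalarIntertwining (ρ j) (hlin j) (π ^ n)).isIntertwining σ w) },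
    fun j n x ↦ rfl⟩

variable {ρ hlin f π Fil hΓ}
variable {q : ∀ a b, ((ρ a).quotient (Fil a) (hΓ a)).toContRepresentation →ⁱL
    ((ρ b).quotient (Fil b) (hΓ b)).toContRepresentation}
  (hq : ∀ a b (x : W a), q a b (Submodule.Quotient.mk x) = Submodule.Quotient.mk (f a b x))
  {πq : ∀ j (n : ℕ), ((ρ j).quotient (Fil j) (hΓ j)).toContRepresentation →ⁱL
    ((ρ j).quotient (Fil j) (hΓ j)).toContRepresentation}
  (hπq : ∀ j n (x : W j), πq j n (Submodule.Quotient.mk x) = Submodule.Quotient.mk (π ^ n • x))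

include hq hπq in
/-- `q a b ∘ πq a n = πq b n ∘ q a b` on `W_a ⧸ Fil_a` (the `Quot`-morphisms are `R`-linear).
[cite: Howard2004HeegnerKolyvagin, Def. 1.1.3 (arXiv p. 5 L93–99)] -/
theorem quot_apply_quotPow (hfR : ∀ a b (r : R) (x : W a), f a b (r • x) = r • f a b x) (a b n : ℕ)
    (y : W a ⧸ Fil a) : q a b (πq a n y) = πq b n (q a b y) := by
  induction y using Submodule.Quotient.induction_on with
  | _ x => rw [hπq, hq, hq, hπq, hfR]

include hπq in
/-- `πq j 1 ∘ πq j n = πq j (n+1)`. [cite: Howard2004HeegnerKolyvagin, Def. 1.1.1 (arXiv p. 5 L20–21)] -/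
theorem quotPow_one_apply_quotPow (j n : ℕ) (y : W j ⧸ Fil j) : πq j 1 (πq j n y) = πq j (n + 1) y := by
  induction y using Submodule.Quotient.induction_on with
  | _ x => rw [hπq, hπq, hπq, pow_one, pow_succ', mul_smul]

include hπq in
/-- `πq j 0 = id`. [cite: Howard2004HeegnerKolyvagin, Def. 1.1.1 (arXiv p. 5 L20–21)] -/
theorem quotPow_zero_apply (j : ℕ) (y : W j ⧸ Fil j) : πq j 0 y = y := by
  induction y using Submodule.Quotient.induction_on with
  | _ x => rw [hπq, pow_zero, one_smul]

include hq hπq in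
/-- `q ℓ (ℓ+n) ∘ q (ℓ+n) ℓ = πq (ℓ+n) n` (`hpow` on the quotient tower).
[cite: Howard2004HeegnerKolyvagin, Def. 1.1.3 (arXiv p. 5 L93–99)] -/
theorem quot_up_down_apply (hpow : ∀ ℓ n (x : W (ℓ + n)), f ℓ (ℓ + n) (f (ℓ + n) ℓ x) = π ^ n • x) (ℓ n : ℕ)
    (y : W (ℓ + n) ⧸ Fil (ℓ + n)) : q ℓ (ℓ + n) (q (ℓ + n) ℓ y) = πq (ℓ + n) n y := by
  induction y using Submodule.Quotient.induction_on with
  | _ x => rw [hq, hq, hpow, hπq]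

include hπq in
/-- `πq j m = (-p) •` on `W_j ⧸ Fil_j` when `(π^m + p) · W_j = 0`. [cite: Howard2004HeegnerKolyvagin, proof of Thm. 2.2.10 (arXiv; 𝔮 = T^m + p)] -/
theorem quotPow_apply_eq_neg_zsmul (p : ℕ) {m : ℕ} (hqm : ∀ j (x : W j), π ^ m • x + (p : ℤ) • x = 0) (j : ℕ)
    (y : W j ⧸ Fil j) : πq j m y = (-(p : ℤ)) • y := by
  induction y using Submodule.Quotient.induction_on with
  | _ z =>
    have h1 : π ^ m • z = (-(p : ℤ)) • z := (eq_neg_of_add_eq_zero_left (hqm j z)).trans (neg_smul _ _).symm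
    rw [hπq, h1]
    exact Submodule.Quotient.mk_smul (Fil j) (-(p : ℤ)) z

/-! ## §3 Functoriality on `H¹`: `hprπ`, `hπG`, powers, up–down -/

include hπq in
/-- (hprπ) `pr_j ∘ H¹(π •) = H¹(πq j 1) ∘ pr_j`. [cite: Howard2004HeegnerKolyvagin, Def. 1.1.1 (arXiv p. 5 L20–21)] [cite: SerreGaloisCohomology1997, Ch. I §2.2] -/
theorem quotientMap_scalarMapH1_eq (j : ℕ) (x : galoisCohomology (ρ j) 1) :
    (ρ j).quotientMap (Fil j) (hΓ j) 1 (galoisCohomology.scalarMapH1 (ρ j) (hlin j) π x) =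
      galoisCohomology.map (πq j 1) 1 ((ρ j).quotientMap (Fil j) (hΓ j) 1 x) := by
  obtain ⟨φ, rfl⟩ := oneCocycleClass_surjective (ρ j).toTopRep x
  change ContinuousCohomology.map _ _ 1 (ContinuousCohomology.map _ _ 1 _) =
    ContinuousCohomology.map _ _ 1 (ContinuousCohomology.map _ _ 1 _)
  rw [map_oneCocycleClass, map_oneCocycleClass, map_oneCocycleClass, map_oneCocycleClass]
  refine congrArg _ (Subtype.ext (ContinuousMap.ext fun σ ↦ ?_))
  change Submodule.Quotient.mk (π • φ.1 σ) = πq j 1 (Submodule.Quotient.mk (φ.1 σ))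
  rw [hπq, pow_one]

include hq hπq in
/-- (hπG) `H¹(q a b) ∘ H¹(πq a n) = H¹(πq b n) ∘ H¹(q a b)`. [cite: Howard2004HeegnerKolyvagin, Def. 1.1.3 (arXiv p. 5 L93–99)] [cite: SerreGaloisCohomology1997, Ch. I §2.2] -/
theorem map_quot_map_quotPow (hfR : ∀ a b (r : R) (x : W a), f a b (r • x) = r • f a b x) (a b n : ℕ)
    (w : galoisCohomology ((ρ a).quotient (Fil a) (hΓ a)) 1) :
    galoisCohomology.map (q a b) 1 (galoisCohomology.map (πq a n) 1 w) =
      galoisCohomology.map (πq b n) 1 (galoisCohomology.map (q a b) 1 w) :=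
  (galoisCohomology.map_map_of_comp_apply (πq a n) (q a b) ((q a b).comp (πq a n)) (fun _ ↦ rfl) w).trans
    ((galoisCohomology.map_congr_apply ((q a b).comp (πq a n)) ((πq b n).comp (q a b))
      (fun y ↦ quot_apply_quotPow hq hπq hfR a b n y) w).trans
      (galoisCohomology.map_map_of_comp_apply (q a b) (πq b n) ((πq b n).comp (q a b)) (fun _ ↦ rfl) w).symm)

include hπq in
/-- Powers: `H¹(πq j 1)^n = H¹(πq j n)`. [cite: SerreGaloisCohomology1997, Ch. I §2.2] -/
theorem map_quotPow_one_pow (j n : ℕ) (w : galoisCohomology ((ρ j).quotient (Fil j) (hΓ j)) 1) :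
    ((@id (AddMonoid.End _) (galoisCohomology.map (πq j 1) 1)) ^ n) w = galoisCohomology.map (πq j n) 1 w := by
  induction n generalizing w with
  | zero =>
    rw [pow_zero, AddMonoid.End.one_apply]
    exact (map_apply_eq_self_of_forall_apply_eq (πq j 0) (fun y ↦ quotPow_zero_apply hπq j y) w).symm
  | succ n ih =>
    rw [endPow_succ_apply', ih]
    exact (galoisCohomology.map_map_of_comp_apply (πq j n) (πq j 1) ((πq j 1).comp (πq j n)) (fun _ ↦ rfl) w).trans
      (galoisCohomology.map_congr_apply ((πq j 1).comp (πq j n)) (πq j (n + 1))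
        (fun y ↦ quotPow_one_apply_quotPow hπq j n y) w)

include hq hπq in
/-- `H¹(q ℓ (ℓ+n)) ∘ H¹(q (ℓ+n) ℓ) = H¹(πq (ℓ+n) n)`. [cite: Howard2004HeegnerKolyvagin, Def. 1.1.3 (arXiv p. 5 L93–99)] [cite: SerreGaloisCohomology1997, Ch. I §2.2] -/
theorem map_quot_up_down (hpow : ∀ ℓ n (x : W (ℓ + n)), f ℓ (ℓ + n) (f (ℓ + n) ℓ x) = π ^ n • x) (ℓ n : ℕ)
    (w : galoisCohomology ((ρ (ℓ + n)).quotient (Fil (ℓ + n)) (hΓ (ℓ + n))) 1) :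
    galoisCohomology.map (q ℓ (ℓ + n)) 1 (galoisCohomology.map (q (ℓ + n) ℓ) 1 w) =
      galoisCohomology.map (πq (ℓ + n) n) 1 w :=
  (galoisCohomology.map_map_of_comp_apply (q (ℓ + n) ℓ) (q ℓ (ℓ + n)) ((q ℓ (ℓ + n)).comp (q (ℓ + n) ℓ))
      (fun _ ↦ rfl) w).trans
    (galoisCohomology.map_congr_apply ((q ℓ (ℓ + n)).comp (q (ℓ + n) ℓ)) (πq (ℓ + n) n)
      (fun y ↦ quot_up_down_apply hq hπq hpow ℓ n y) w)

/-! ## §4 The torsion cut is `{y | π^r · y ∈ H¹_str}` -/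

include hπq in
/-- **The torsion cut of `TowerTorsionCutProofs` is the preimage of the strict condition under `H¹(π^r •)`**:
`{y | H¹(πq N 1)^r (pr y) = 0} = (strictSubgroup).comap H¹(π^r •)`. [cite: Howard2004HeegnerKolyvagin, §3.1 and Lemma 3.2.7 (arXiv p. 15 L62–66, p. 16)]
[cite: WashingtonCSS1997, §7 Choice 2] -/
theorem comap_ker_pow_eq_comap_strictSubgroup (N r : ℕ) :
    (AddMonoidHom.ker ((@id (AddMonoid.End _) (galoisCohomology.map (πq N 1) 1)) ^ r)).comap
        ((ρ N).quotientMap (Fil N) (hΓ N) 1) =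
      ((ρ N).strictSubgroup (Fil N) (hΓ N)).comap (galoisCohomology.scalarMapH1 (ρ N) (hlin N) (π ^ r)) := by
  ext y
  rw [AddSubgroup.mem_comap, AddSubgroup.mem_comap, mem_strictSubgroup_iff, AddMonoidHom.mem_ker,
    ← scalarMapH1_pow (ρ N) (hlin N) π r y]
  change ((@id (AddMonoid.End _) (galoisCohomology.map (πq N 1) 1)) ^ r) ((ρ N).quotientMap (Fil N) (hΓ N) 1 y) = 0 ↔
    (ρ N).quotientMap (Fil N) (hΓ N) 1
      (((@id (AddMonoid.End _) (galoisCohomology.scalarMapH1 (ρ N) (hlin N) π)) ^ r) y) = 0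
  rw [pow_apply_comm_of_comm ((ρ N).quotientMap (Fil N) (hΓ N) 1)
    (@id (AddMonoid.End _) (galoisCohomology.scalarMapH1 (ρ N) (hlin N) π))
    (@id (AddMonoid.End _) (galoisCohomology.map (πq N 1) 1))
    (fun x ↦ quotientMap_scalarMapH1_eq hπq N x) r y]

/-! ## §5 (hE), (hSat), (hπ1) from the presentation -/

include hq hπq in
/-- **(hE) for the quotient tower** in the shape of `TowerTorsionCutProofs`: a compatible family of `H¹(F, W_j ⧸ Fil_j)` vanishing
at level `k` is `H¹(πq j k)` of a compatible family from level `k` on (x10b-p1-w7's (E) on the induced family + `hpow`).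
[cite: Howard2004HeegnerKolyvagin, §1.6 and Lemma 3.2.7 (arXiv p. 12 L29–55, p. 16 L142–148)] [cite: SerreGaloisCohomology1997, Ch. I §2.2] -/
theorem quot_exists_forall_eq_map_quotPow_of_apply_eq_zero [∀ j, Finite (galoisCohomology ((ρ j).quotient (Fil j) (hΓ j)) 1)]
    (hid : ∀ a (w : W a), f a a w = w)
    (hcomp : ∀ a b c, c ≤ b → b ≤ a → ∀ w : W a, f b c (f a b w) = f a c w)
    (hsq : ∀ a b, a ≤ b → ∀ w : W (a + 1), f a b (f (a + 1) a w) = f (b + 1) b (f (a + 1) (b + 1) w))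
    (hsurj : ∀ ℓ n, Function.Surjective (f (ℓ + n) n))
    (hex : ∀ ℓ n (y : W (ℓ + n)), f (ℓ + n) n y = 0 ↔ ∃ x, f ℓ (ℓ + n) x = y)
    (hpow : ∀ ℓ n (x : W (ℓ + n)), f ℓ (ℓ + n) (f (ℓ + n) ℓ x) = π ^ n • x)
    (hmapF : ∀ a b, ∀ w ∈ Fil a, f a b w ∈ Fil b)
    (hontoF : ∀ ℓ n, ∀ w' ∈ Fil n, ∃ w ∈ Fil (ℓ + n), f (ℓ + n) n w = w')
    (hsatF : ∀ ℓ n (w : W ℓ), f ℓ (ℓ + n) w ∈ Fil (ℓ + n) → w ∈ Fil ℓ)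
    (w : Π j, galoisCohomology ((ρ j).quotient (Fil j) (hΓ j)) 1)
    (hw : w ∈ compatibleFamilies (H := fun j ↦ galoisCohomology ((ρ j).quotient (Fil j) (hΓ j)) 1)
      (fun j ↦ galoisCohomology.map (q (j + 1) j) 1))
    (k : ℕ) (hwk : w k = 0) :
    ∃ h ∈ compatibleFamilies (H := fun j ↦ galoisCohomology ((ρ j).quotient (Fil j) (hΓ j)) 1)
        (fun j ↦ galoisCohomology.map (q (j + 1) j) 1),
      ∀ j, k ≤ j → w j = galoisCohomology.map (πq j k) 1 (h j) := by
  have hidG := quotFamily_id hq hid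
  have hcompG := quotFamily_comp hq hcomp
  have hsqG := quotFamily_sq hq hsq
  have hinjG := quotFamily_injective hq hsatF
  have hsurjG := quotFamily_surjective hq hsurj
  have hexG := quotFamily_exact hq hmapF hex hontoF
  obtain ⟨h, hh, hwh⟩ := exists_forall_map_eq_of_apply_eq_zero (fun j ↦ (ρ j).quotient (Fil j) (hΓ j)) q
    hidG hcompG hsqG hinjG hsurjG hexG k hw hwk
  refine ⟨h, hh, fun j hj ↦ ?_⟩
  obtain ⟨ℓ, rfl⟩ := Nat.exists_eq_add_of_le' hj
  have h1 : h ℓ = galoisCohomology.map (q (ℓ + k) ℓ) 1 (h (ℓ + k)) :=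
    (map_apply_eq_of_mem (fun j ↦ (ρ j).quotient (Fil j) (hΓ j)) q hidG hcompG hh (Nat.le_add_right ℓ k)).symm
  calc w (ℓ + k) = galoisCohomology.map (q ℓ (ℓ + k)) 1 (h ℓ) := (hwh ℓ).symm
    _ = galoisCohomology.map (q ℓ (ℓ + k)) 1 (galoisCohomology.map (q (ℓ + k) ℓ) 1 (h (ℓ + k))) := by rw [← h1]
    _ = galoisCohomology.map (πq (ℓ + k) k) 1 (h (ℓ + k)) := map_quot_up_down hq hπq hpow ℓ k _

include hπq in
/-- **(hSat) from `(π^m + p) · W = 0`**: a compatible family `x` of `H¹(F, W_j)` with `H¹(πq j r) (pr x_j) = 0` (`r ≤ m`) is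
`p`-saturated for the strict cores (`p · pr x_j = −π^m · pr x_j = 0`).
[cite: Howard2004HeegnerKolyvagin, Def. 3.1.2 and proof of Thm. 2.2.10 (arXiv p. 15 L99–108; 𝔮 = T^m + p)] -/
theorem mem_saturatedFamilies_of_map_quotPow_eq_zero (p : ℕ) {m r : ℕ} (hrm : r ≤ m)
    (hqm : ∀ j (x : W j), π ^ m • x + (p : ℤ) • x = 0)
    {x : Π j, galoisCohomology (ρ j) 1}
    (hx : x ∈ compatibleFamilies (H := fun j ↦ galoisCohomology (ρ j) 1) (fun j ↦ galoisCohomology.map (f (j + 1) j) 1))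
    (hxr : ∀ j, galoisCohomology.map (πq j r) 1 ((ρ j).quotientMap (Fil j) (hΓ j) 1 (x j)) = 0) :
    x ∈ saturatedFamilies (H := fun j ↦ galoisCohomology (ρ j) 1) (fun j ↦ galoisCohomology.map (f (j + 1) j) 1) p
      (fun j ↦ (ρ j).strictSubgroup (Fil j) (hΓ j)) := by
  refine ⟨hx, 1, fun j ↦ ?_⟩
  rw [pow_one, mem_strictSubgroup_iff, map_nsmul]
  have hneg : galoisCohomology.map (πq j m) 1 ((ρ j).quotientMap (Fil j) (hΓ j) 1 (x j)) =
      (-(p : ℤ)) • (ρ j).quotientMap (Fil j) (hΓ j) 1 (x j) :=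
    map_eq_zsmul_of_forall_apply_eq (πq j m) (-(p : ℤ)) (fun y ↦ quotPow_apply_eq_neg_zsmul hπq p hqm j y) _
  have hm0 : galoisCohomology.map (πq j m) 1 ((ρ j).quotientMap (Fil j) (hΓ j) 1 (x j)) = 0 := by
    obtain ⟨d, rfl⟩ := Nat.exists_eq_add_of_le hrm
    have hr0 : ((@id (AddMonoid.End _) (galoisCohomology.map (πq j 1) 1)) ^ r)
        ((ρ j).quotientMap (Fil j) (hΓ j) 1 (x j)) = 0 := by
      rw [map_quotPow_one_pow hπq]; exact hxr j
    rw [← map_quotPow_one_pow hπq, add_comm, endPow_add_apply, hr0, map_zero]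
  rw [hm0, neg_smul, zero_eq_neg, natCast_zsmul] at hneg
  exact hneg

/-- (hπ1) `H¹(π •) = 0` on `H¹(F, W_j)` when `π · W_j = 0`. [cite: Howard2004HeegnerKolyvagin, §1.6 (arXiv p. 12: T/πT = T̄)] -/
theorem scalarMapH1_eq_zero_of_forall_smul_eq_zero (j : ℕ) (hπW : ∀ x : W j, π • x = 0) (c : galoisCohomology (ρ j) 1) :
    galoisCohomology.scalarMapH1 (ρ j) (hlin j) π c = 0 :=
  galoisCohomology.map_eq_zero_of_apply_eq_zero (scalarIntertwining (ρ j) (hlin j) π) (fun x ↦ hπW x) c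

/-! ## §6 The main theorem on a presented tower -/

include hq hπq in
/-- **The residual image of the saturated strict condition is the residual image of `{π^r · y ∈ H¹_str}`** on a presented tower
with scalars.  Hypotheses: the presentation (`hid/hcomp/hsq/hsurj/hex/hpow`, `R`-linearity `hfR`), the plus parts
(`hmapF/hontoF/hsatF`), `(π^m + p) · W = 0` and `π · W_1 = 0`, `r ≤ m`, `r + c + c' + 1 ≤ N`, and the three cohomological inputs
(hTor), (hF2), (hLift).  Conclusion: Howard's propagated condition read inside the single level `N`.
[cite: Howard2004HeegnerKolyvagin, §1.3 H.5(b), Def. 3.1.2, §3.1 and Lemma 3.2.7 (arXiv:1202.6340 p. 7 L96–97, p. 15 L99–108, p. 16 L142–160)]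
[cite: MazurRubinMemoirs2004, Def. 1.1.1 and Example 1.1.2] [cite: SerreGaloisCohomology1997, Ch. I §2.2] -/
theorem map_levelCondition_eq_map_comap_strict [∀ j, Finite (galoisCohomology (ρ j) 1)]
    [∀ j, Finite (galoisCohomology ((ρ j).quotient (Fil j) (hΓ j)) 1)]
    (hfR : ∀ a b (r : R) (x : W a), f a b (r • x) = r • f a b x)
    (hid : ∀ a (w : W a), f a a w = w)
    (hcomp : ∀ a b c, c ≤ b → b ≤ a → ∀ w : W a, f b c (f a b w) = f a c w)
    (hsq : ∀ a b, a ≤ b → ∀ w : W (a + 1), f a b (f (a + 1) a w) = f (b + 1) b (f (a + 1) (b + 1) w))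
    (hsurj : ∀ ℓ n, Function.Surjective (f (ℓ + n) n))
    (hex : ∀ ℓ n (y : W (ℓ + n)), f (ℓ + n) n y = 0 ↔ ∃ x, f ℓ (ℓ + n) x = y)
    (hpow : ∀ ℓ n (x : W (ℓ + n)), f ℓ (ℓ + n) (f (ℓ + n) ℓ x) = π ^ n • x)
    (hmapF : ∀ a b, ∀ w ∈ Fil a, f a b w ∈ Fil b)
    (hontoF : ∀ ℓ n, ∀ w' ∈ Fil n, ∃ w ∈ Fil (ℓ + n), f (ℓ + n) n w = w')
    (hsatF : ∀ ℓ n (w : W ℓ), f ℓ (ℓ + n) w ∈ Fil (ℓ + n) → w ∈ Fil ℓ)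
    (p : ℕ) {m N r c c' : ℕ} (hrm : r ≤ m) (hN : r + c + c' + 1 ≤ N)
    (hqm : ∀ j (x : W j), π ^ m • x + (p : ℤ) • x = 0) (hπW1 : ∀ x : W 1, π • x = 0)
    (hTor : ∀ w ∈ compatibleFamilies (H := fun j ↦ galoisCohomology ((ρ j).quotient (Fil j) (hΓ j)) 1)
        (fun j ↦ galoisCohomology.map (q (j + 1) j) 1),
      ∀ a : ℕ, (∀ j, p ^ a • w j = 0) → ∀ j, galoisCohomology.map (πq j r) 1 (w j) = 0)
    (hF2 : ∀ j (w : galoisCohomology ((ρ j).quotient (Fil j) (hΓ j)) 1), ∃ z : galoisCohomology (ρ j) 1,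
      (ρ j).quotientMap (Fil j) (hΓ j) 1 z = galoisCohomology.map (πq j c) 1 w)
    (hLift : ∀ y : galoisCohomology (ρ N) 1, ∃ x ∈ compatibleFamilies (H := fun j ↦ galoisCohomology (ρ j) 1)
        (fun j ↦ galoisCohomology.map (f (j + 1) j) 1),
      galoisCohomology.map (f N (N - c')) 1 (x N) = galoisCohomology.map (f N (N - c')) 1 y) :
    (levelCondition (H := fun j ↦ galoisCohomology (ρ j) 1) (fun j ↦ galoisCohomology.map (f (j + 1) j) 1) p
        (fun j ↦ (ρ j).strictSubgroup (Fil j) (hΓ j)) N).map (galoisCohomology.map (f N 1) 1) =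
      (((ρ N).strictSubgroup (Fil N) (hΓ N)).comap (galoisCohomology.scalarMapH1 (ρ N) (hlin N) (π ^ r))).map
        (galoisCohomology.map (f N 1) 1) := by
  rw [← comap_ker_pow_eq_comap_strictSubgroup hπq N r]
  exact map_levelCondition_eq_map_torsionCut (H := fun j ↦ galoisCohomology (ρ j) 1)
    (G := fun j ↦ galoisCohomology ((ρ j).quotient (Fil j) (hΓ j)) 1)
    (fun a b ↦ galoisCohomology.map (f a b) 1) (fun a b ↦ galoisCohomology.map (q a b) 1)
    (fun j ↦ (ρ j).quotientMap (Fil j) (hΓ j) 1)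
    (fun j ↦ @id (AddMonoid.End _) (galoisCohomology.scalarMapH1 (ρ j) (hlin j) π))
    (fun j ↦ @id (AddMonoid.End _) (galoisCohomology.map (πq j 1) 1))
    (fun a x ↦ map_apply_eq_self_of_forall_apply_eq (f a a) (hid a) x)
    (fun a b c hcb hba x ↦ galoisCohomology.map_map_of_comp_apply (f a b) (f b c) (f a c)
      (fun w ↦ (hcomp a b c hcb hba w).symm) x)
    (fun a b _ x ↦ quotientMap_map_eq_map_quotientMap hq a b x)
    (fun a b _ x ↦ galoisCohomology.map_scalarMapH1 (hlin a) (hlin b) (f a b) (hfR a b) π x)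
    (fun a b _ w ↦ map_quot_map_quotPow hq hπq hfR a b 1 w)
    (fun j x ↦ quotientMap_scalarMapH1_eq hπq j x)
    p hN (fun x ↦ scalarMapH1_eq_zero_of_forall_smul_eq_zero 1 hπW1 x)
    (fun w hw a ha j ↦ by rw [map_quotPow_one_pow hπq]; exact hTor w hw a ha j)
    (fun x hx hxr ↦ mem_saturatedFamilies_of_map_quotPow_eq_zero hπq p hrm hqm hx
      (fun j ↦ by rw [← map_quotPow_one_pow hπq]; exact hxr j))
    (fun w hw k hwk ↦ by
      obtain ⟨h, hh, hwh⟩ := quot_exists_forall_eq_map_quotPow_of_apply_eq_zero hq hπq hid hcomp hsq hsurj hex hpow hmapF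
        hontoF hsatF w hw k hwk
      exact ⟨h, hh, fun j hj ↦ by rw [map_quotPow_one_pow hπq]; exact hwh j hj⟩)
    (fun j w ↦ by
      obtain ⟨z, hz⟩ := hF2 j w
      exact ⟨z, by rw [map_quotPow_one_pow hπq]; exact hz⟩)
    hLift

end Tower

end Literature.NumberTheory.EllipticCurves

end
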